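import Literature.MathematicalPhysics.QuantumFieldTheory.CubicalCochains
import Literature.MathematicalPhysics.QuantumFieldTheory.StrongCouplingTorusSystem
import HarnessLib

/-!
# Cubical cochains on the discrete torus `(ℤ/Lℤ)^d`: coboundaries, small closed `2`-cochains are exact

Support file for the low-temperature (contour) expansion of abelian lattice gauge theories on the
tori `(ℤ/Lℤ)^d` (discharge of `Literature.Barriers.QuantumFields.ZnHiggsPhaseD4` through the torus
core facts of `DiscreteSubgroupFreezingProofs.lean`). Companion of `CubicalCochains.lean` (the
`ℤ^d` calculus and its Poincaré lemma `LatticeForm.exists_d₁_eq_of_d₂_eq_zero_of_three_le`).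

## Contents (everything is proved)

* Torus coboundaries `LatticeForm.td₁`, `LatticeForm.td₂` on `Site d L = (ℤ/Lℤ)^d` (same formulas as
  on `ℤ^d`; `td₁` of an abelian gauge field, written additively, is its plaquette field),
  `td₂_td₁ : td₂ ∘ td₁ = 0` (Bianchi identity), alternation, and
  `td₂_eq_zero_of_sorted` (for an alternating `2`-cochain, closedness on the genuine `3`-cells
  `i < j < k` gives closedness on all index triples).
* **Small closed `2`-cochains on the torus are exact, with support control**
  (`LatticeForm.exists_td₁_eq_of_liftBox`): if an alternating closed `2`-cochain `ω` on the torus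
  is supported on plaquettes whose base points, in the canonical coordinates `{0,…,L-1}^d`
  (`torusSiteLift`), lie in a box `[a, b]` with `1 ≤ a`, `b ≤ L - 2` (i.e. the support stays away
  from the "seam" of the torus), then `ω = td₁ θ` with `θ` supported (base points of non-zero
  edges, canonical coordinates) in the same box `[a, b]`. Proof: cut the torus open along the
  seam — the extension by zero of `ω` to `ℤ^d` is closed (`d₂_liftCochain`) — apply the `ℤ^d`
  Poincaré lemma with compact supports, and push the primitive (supported inside the fundamental
  domain, away from the seam) back to the torus (`td₁_pushCochain`). This is the topological
  input "a closed vortex which does not wrap around the torus is a boundary" of the contour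
  expansion (for boxes in `ℤ⁴` cf. Forsström–Lenells–Viklund 2022, Lemma 2.2).
* Torus translations of cochains (`shiftCochain₁`, `shiftCochain₂`) commute with the
  coboundaries; for every set `S` of sites with `2|S| < L` there is a translation moving all of
  them off the residues `0, -1` in every coordinate (`exists_shift_away`, `val_mem_of_ne`), so a
  support of fewer than `L/2` plaquettes can be translated away from the seam.
* Genuine plaquettes (Wave 0's `Plaquette d L`): `res`/`ext` between alternating `2`-cochains and
  functions of genuine plaquettes, closedness `IsClosedPl`, the six `cubeFaces` of a genuine
  `3`-cell and the flux formula `td₂_ext_sorted`, **cube adjacency** `CubeAdj` (two plaquettes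
  bounding a common `3`-cell; Forsström 2022 §1.3) with the candidate neighbourhood `cubeNbr`
  (`mem_cubeNbr_of_cubeAdj`, `card_cubeNbr_le`: degree `≤ 6(d+1)d³`) and `CubeAdj.coord_sub`
  (adjacent plaquettes have base points within `1` in every coordinate), restriction `restrictPl`
  to a plaquette set and `isClosedPl_restrictPl` (a face-saturated restriction of a closed
  function is closed — whence the cube-connected components of a vortex configuration are closed).
* **Abelian Stokes for rectangles** (`lineSum_rect_eq_sum_td₁`): the boundary line sum of a
  `1`-cochain around an `R × T` lattice rectangle is the sum of its plaquette variables.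

## References

* M. P. Forsström, J. Lenells, F. Viklund, *Wilson loops in finite Abelian lattice gauge
  theories*, Ann. Inst. H. Poincaré Probab. Stat. 58 (2022), §2. [ForsstromLenellsViklund2022]
* M. P. Forsström, *Decay of correlations in finite Abelian lattice gauge theories*, Comm. Math.
  Phys. 393 (2022), §2 (discrete exterior calculus; Remark 7 on periodic boundary conditions).
  [Forsstrom2022]
-/

open Finset Function

namespace Literature.MathematicalPhysics.QuantumFieldTheory

namespace LatticeForm

open Literature.Probability.LatticeModels (Torus.proj Torus.proj_apply)

variable {d L : ℕ} {A : Type*} [AddCommGroup A]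

/-! ### Torus coboundaries -/

/-- The unit vector `eᵢ` of the discrete torus `(ℤ/Lℤ)^d`. [folklore] -/
abbrev te (i : Fin d) : Site d L := Pi.single i 1

/-- `td₁ θ (x; i, j) = θ(x,i) + θ(x+eᵢ,j) - θ(x+eⱼ,i) - θ(x,j)` on the torus: the (additive)
plaquette field of the abelian lattice gauge field `θ` (same orientation as
`plaquetteHolonomy`). [cite: ForsstromLenellsViklund2022, §2.3.2 (exterior derivative)] -/
def td₁ (θ : Site d L → Fin d → A) : Site d L → Fin d → Fin d → A :=
  fun x i j => θ x i + θ (x + te i) j - θ (x + te j) i - θ x j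

/-- `td₂ ω (x; i, j, k) = ∂ᵢ ω_{jk} - ∂ⱼ ω_{ik} + ∂_k ω_{ij}` on the torus (`∂ᵢ h(x) = h(x+eᵢ) - h(x)`):
the flux of the `2`-cochain `ω` through the boundary of the `3`-cell at `x` spanned by
`eᵢ, eⱼ, e_k`, same orientation convention as `LatticeForm.d₂`. [cite: ForsstromLenellsViklund2022, §2.3.2 (exterior derivative)] -/
def td₂ (ω : Site d L → Fin d → Fin d → A) :
    Site d L → Fin d → Fin d → Fin d → A :=
  fun x i j k => (ω (x + te i) j k - ω x j k) - (ω (x + te j) i k - ω x i k) + (ω (x + te k) i j - ω x i j)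

/-- `td₁` is antisymmetric in the directions. [folklore] -/
theorem td₁_swap (θ : Site d L → Fin d → A) (x : Site d L)
    (i j : Fin d) : td₁ θ x j i = -td₁ θ x i j := by
  simp only [td₁]; abel

/-- `td₁` vanishes on the diagonal. [folklore] -/
@[simp] theorem td₁_self (θ : Site d L → Fin d → A)
    (x : Site d L) (i : Fin d) : td₁ θ x i i = 0 := by
  simp only [td₁]; abel

/-- **Bianchi identity on the torus**: `td₂ ∘ td₁ = 0`. [cite: ForsstromLenellsViklund2022, §2.3.2 (dd = 0)] -/
theorem td₂_td₁ (θ : Site d L → Fin d → A) : td₂ (td₁ θ) = 0 := by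
  funext x i j k
  simp only [td₂, td₁, Pi.zero_apply]
  rw [add_right_comm x (te i) (te j), add_right_comm x (te i) (te k),
    add_right_comm x (te j) (te k)]
  abel

/-- `td₁ (θ - θ') = td₁ θ - td₁ θ'`. [folklore] -/
theorem td₁_sub (θ θ' : Site d L → Fin d → A) : td₁ (θ - θ') = td₁ θ - td₁ θ' := by
  funext x i j; simp only [td₁, Pi.sub_apply]; abel

/-- `td₁ (θ + θ') = td₁ θ + td₁ θ'`. [folklore] -/
theorem td₁_add (θ θ' : Site d L → Fin d → A) : td₁ (θ + θ') = td₁ θ + td₁ θ' := by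
  funext x i j; simp only [td₁, Pi.add_apply]; abel

/-- `td₂ (ω + ω') = td₂ ω + td₂ ω'`. [folklore] -/
theorem td₂_add (ω ω' : Site d L → Fin d → Fin d → A) :
    td₂ (ω + ω') = td₂ ω + td₂ ω' := by
  funext x i j k; simp only [td₂, Pi.add_apply]; abel

/-- `td₂` of a finite sum. [folklore] -/
theorem td₂_sum {ι : Type*} (s : Finset ι) (ω : ι → Site d L → Fin d → Fin d → A) :
    td₂ (∑ c ∈ s, ω c) = ∑ c ∈ s, td₂ (ω c) := by
  classical
  induction s using Finset.induction_on with
  | empty => funext x i j k; simp [td₂]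
  | insert a s ha ih => rw [Finset.sum_insert ha, Finset.sum_insert ha, td₂_add, ih]

/-- A `2`-cochain is *alternating*: antisymmetric with zero diagonal. [folklore] -/
def IsAlt {X : Type*} (ω : X → Fin d → Fin d → A) : Prop :=
  (∀ x i j, ω x j i = -ω x i j) ∧ ∀ x i, ω x i i = 0

/-- `td₁ θ` is alternating. [folklore] -/
theorem isAlt_td₁ (θ : Site d L → Fin d → A) : IsAlt (td₁ θ) :=
  ⟨fun x i j => td₁_swap θ x i j, fun x i => td₁_self θ x i⟩

/-- **Closedness on genuine `3`-cells suffices.** For an alternating `2`-cochain on the torus,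
`td₂ ω (x; i, j, k) = 0` for all sorted triples `i < j < k` implies it for all index triples
(degenerate triples by alternation, permuted ones up to sign). [folklore] -/
theorem td₂_eq_zero_of_sorted {ω : Site d L → Fin d → Fin d → A} (halt : IsAlt ω)
    (h : ∀ x (i j k : Fin d), i < j → j < k → td₂ ω x i j k = 0) (x : Site d L)
    (i j k : Fin d) : td₂ ω x i j k = 0 := by
  obtain ⟨ha, hd⟩ := halt
  -- the value on a permuted triple is `±` the value on the sorted one
  have hswap12 : ∀ y (i j k : Fin d), td₂ ω y j i k = -td₂ ω y i j k := by
    intro y i j k; simp only [td₂]; rw [ha y i j, ha (y + te k) i j]; abel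
  have hswap23 : ∀ y (i j k : Fin d), td₂ ω y i k j = -td₂ ω y i j k := by
    intro y i j k; simp only [td₂]; rw [ha y j k, ha (y + te i) j k]; abel
  -- degenerate triples
  have hdeg12 : ∀ y (i k : Fin d), td₂ ω y i i k = 0 := by
    intro y i k; simp only [td₂, hd]; abel
  have hdeg23 : ∀ y (i j : Fin d), td₂ ω y i j j = 0 := by
    intro y i j; simp only [td₂, hd]; abel
  have hdeg13 : ∀ y (i j : Fin d), td₂ ω y i j i = 0 := by
    intro y i j; rw [hswap23, hdeg12, neg_zero]
  rcases lt_trichotomy i j with hij | rfl | hij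
  · rcases lt_trichotomy j k with hjk | rfl | hjk
    · exact h x i j k hij hjk
    · exact hdeg23 x i j
    · rcases lt_trichotomy i k with hik | rfl | hik
      · rw [hswap23, h x i k j hik hjk, neg_zero]
      · exact hdeg13 x i j
      · rw [hswap23, hswap12, h x k i j hik hij, neg_zero, neg_zero]
  · exact hdeg12 x i k
  · rcases lt_trichotomy i k with hik | rfl | hik
    · rw [hswap12, h x j i k hij hik, neg_zero]
    · exact hdeg13 x i j
    · rcases lt_trichotomy j k with hjk | rfl | hjk
      · rw [hswap12, hswap23, h x j k i hjk hik, neg_zero, neg_zero]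
      · exact hdeg23 x i j
      · rw [hswap12, hswap23, hswap12, h x k j i hjk hij]; simp

/-! ### Cutting the torus open: lift to `ℤ^d` and push-forward -/

section Transfer

variable [NeZero L]

/-- The fundamental domain `{0, …, L-1}^d ⊆ ℤ^d` as a box. [folklore] -/
def fundBox (d L : ℕ) : Set (Literature.Probability.LatticeModels.Site d) := Set.Icc 0 (fun _ => (L : ℤ) - 1)

/-- The canonical lift of a torus site lies in the fundamental domain. [folklore] -/
theorem torusSiteLift_mem_fundBox (y : Site d L) : torusSiteLift y ∈ fundBox d L := by
  refine ⟨fun m => ?_, fun m => ?_⟩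
  · show (0 : ℤ) ≤ ((y m).val : ℤ)
    exact_mod_cast Nat.zero_le _
  · show ((y m).val : ℤ) ≤ (L : ℤ) - 1
    have := ZMod.val_lt (y m)
    omega

/-- On the fundamental domain the canonical lift inverts the projection. [folklore] -/
theorem torusSiteLift_proj {x : Literature.Probability.LatticeModels.Site d} (hx : x ∈ fundBox d L) :
    torusSiteLift (Torus.proj L x : Site d L) = x := by
  funext m
  have h0 : 0 ≤ x m := hx.1 m
  have h1 : x m ≤ (L : ℤ) - 1 := hx.2 m
  simp only [torusSiteLift, Torus.proj_apply]
  rw [ZMod.val_intCast]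
  exact Int.emod_eq_of_lt h0 (by omega)

/-- The canonical coordinate of `y + eₘ`: one more, unless it wraps around. [folklore] -/
theorem torusSiteLift_add_te (y : Site d L) (m : Fin d) :
    torusSiteLift (y + te m) =
      if ((y m).val : ℤ) = L - 1 then update (torusSiteLift y) m 0
      else torusSiteLift y + e m := by
  have hL : 0 < L := Nat.pos_of_ne_zero (NeZero.ne L)
  funext m'
  by_cases hm : m' = m
  · subst hm
    have hval : ((y + te m' : Site d L) m').val = ((y m').val + 1) % L := by
      simp only [Pi.add_apply, te, Pi.single_eq_same]
      rw [ZMod.val_add, ZMod.val_one_eq_one_mod, Nat.add_mod_mod]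
    split_ifs with h
    · rw [update_self]
      show ((((y + te m' : Site d L) m').val : ℕ) : ℤ) = 0
      rw [hval]
      have : (y m').val + 1 = L := by omega
      rw [this, Nat.mod_self, Nat.cast_zero]
    · have hlt : (y m').val + 1 < L := by have := ZMod.val_lt (y m'); omega
      show ((((y + te m' : Site d L) m').val : ℕ) : ℤ) =
        ((y m').val : ℤ) + (e m' : Literature.Probability.LatticeModels.Site d) m'
      rw [hval, Nat.mod_eq_of_lt hlt]
      simp
  · have h1 : (y + te m : Site d L) m' = y m' := by
      simp only [Pi.add_apply, te, Pi.single_eq_of_ne hm, add_zero]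
    split_ifs with h
    · rw [update_of_ne hm]
      show ((((y + te m : Site d L) m').val : ℕ) : ℤ) = ((y m').val : ℤ)
      rw [h1]
    · show ((((y + te m : Site d L) m').val : ℕ) : ℤ) =
        ((y m').val : ℤ) + (e m : Literature.Probability.LatticeModels.Site d) m'
      rw [h1]
      simp [Pi.single_eq_of_ne hm]

/-- Extension by zero of a torus `2`-cochain to `ℤ^d` through the fundamental domain. [folklore] -/
noncomputable def liftCochain (ω : Site d L → Fin d → Fin d → A) : Literature.Probability.LatticeModels.Site d → Fin d → Fin d → A :=
  fun x i j => by
    classical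
    exact if x ∈ fundBox d L then ω (Torus.proj L x) i j else 0

/-- Push-forward of a `ℤ^d` `1`-cochain to the torus through the canonical lift. [folklore] -/
def pushCochain (θ : Literature.Probability.LatticeModels.Site d → Fin d → A) : Site d L → Fin d → A :=
  fun y i => θ (torusSiteLift y) i

/-- The support hypothesis of the transfer: non-zero plaquette values have base points whose
canonical coordinates lie in the box `[a, b]`, itself inside `[1, L-2]^d` (away from the seam).
[folklore] -/
structure LiftBox (ω : Site d L → Fin d → Fin d → A) (a b : Literature.Probability.LatticeModels.Site d) : Prop where
  one_le : ∀ m, 1 ≤ a m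
  le_sub_two : ∀ m, b m ≤ (L : ℤ) - 2
  mem : ∀ y i j, ω y i j ≠ 0 → torusSiteLift y ∈ Set.Icc a b

omit [NeZero L] in
/-- Under `LiftBox`, plaquettes based on the seam (some canonical coordinate `0` or `L-1`) carry
the value zero. [folklore] -/
theorem LiftBox.eq_zero_of_seam {ω : Site d L → Fin d → Fin d → A} {a b : Literature.Probability.LatticeModels.Site d}
    (h : LiftBox ω a b) {y : Site d L} {m : Fin d}
    (hy : ((y m).val : ℤ) = 0 ∨ ((y m).val : ℤ) = L - 1) (i j : Fin d) : ω y i j = 0 := by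
  by_contra hne
  have hmem := h.mem y i j hne
  have h1 := hmem.1 m
  have h2 := hmem.2 m
  have ha := h.one_le m
  have hb := h.le_sub_two m
  simp only [torusSiteLift] at h1 h2
  omega

/-- The lift of a `LiftBox` cochain is supported in the box `[a, b]`. [folklore] -/
theorem liftCochain_ne_zero {ω : Site d L → Fin d → Fin d → A} {a b : Literature.Probability.LatticeModels.Site d}
    (h : LiftBox ω a b) {x : Literature.Probability.LatticeModels.Site d} {i j : Fin d} (hx : liftCochain ω x i j ≠ 0) :
    x ∈ Set.Icc a b := by
  classical
  unfold liftCochain at hx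
  split_ifs at hx with hmem
  · have := h.mem _ i j hx
    rwa [torusSiteLift_proj hmem] at this
  · exact absurd rfl hx

omit [NeZero L] in
/-- The lift is alternating if `ω` is. [folklore] -/
theorem isAlt_liftCochain {ω : Site d L → Fin d → Fin d → A} (hω : IsAlt ω) :
    IsAlt (liftCochain ω) := by
  classical
  refine ⟨fun x i j => ?_, fun x i => ?_⟩
  · unfold liftCochain; split_ifs <;> simp [hω.1 _ i j]
  · unfold liftCochain; split_ifs <;> simp [hω.2 _ i]

/-- Key pointwise identity behind `d₂_liftCochain`: for `x` in the fundamental domain, the lift at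
`x + eₘ` is the torus value at `proj x + eₘ` (if `x + eₘ` leaves the fundamental domain, both
vanish: the torus point lies on the seam). [folklore] -/
theorem liftCochain_add_e {ω : Site d L → Fin d → Fin d → A} {a b : Literature.Probability.LatticeModels.Site d}
    (h : LiftBox ω a b) {x : Literature.Probability.LatticeModels.Site d} (hx : x ∈ fundBox d L) (m i j : Fin d) :
    liftCochain ω (x + e m) i j = ω ((Torus.proj L x : Site d L) + te m) i j := by
  classical
  unfold liftCochain
  have hproj : (Torus.proj L (x + e m) : Site d L) = Torus.proj L x + te m := by
    rw [torusProj_site_add, torusProj_site_single]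
  split_ifs with hmem
  · rw [hproj]
  · -- `x + eₘ ∉ fundBox`: then `x m = L - 1` and the torus point is on the seam
    have hxm : x m = (L : ℤ) - 1 := by
      by_contra hne
      apply hmem
      refine ⟨fun m' => ?_, fun m' => ?_⟩
      · by_cases hm' : m' = m
        · subst hm'; rw [add_single_apply_self]; have := hx.1 m'; simp at this ⊢; omega
        · rw [add_single_apply_of_ne x hm']; exact hx.1 m'
      · by_cases hm' : m' = m
        · subst hm'; rw [add_single_apply_self]; have := hx.2 m'; simp at this ⊢; omega
        · rw [add_single_apply_of_ne x hm']; exact hx.2 m'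
    symm
    refine h.eq_zero_of_seam (m := m) (Or.inl ?_) i j
    rw [← hproj]
    simp only [Torus.proj_apply, Pi.add_apply, Pi.single_eq_same, hxm]
    rw [ZMod.val_intCast]
    simp

omit [NeZero L] in
/-- Outside the fundamental domain, the lift vanishes at `x + eₘ` as well (if `x + eₘ` re-enters
the domain, its projection lies on the seam). [folklore] -/
theorem liftCochain_add_e_of_not_mem {ω : Site d L → Fin d → Fin d → A} {a b : Literature.Probability.LatticeModels.Site d}
    (h : LiftBox ω a b) {x : Literature.Probability.LatticeModels.Site d} (hx : x ∉ fundBox d L) (m i j : Fin d) :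
    liftCochain ω (x + e m) i j = 0 := by
  classical
  unfold liftCochain
  split_ifs with hmem
  · -- `x ∉ fundBox`, `x + eₘ ∈ fundBox`: then `x m = -1`
    have hxm : x m = -1 := by
      by_contra hne
      apply hx
      refine ⟨fun m' => ?_, fun m' => ?_⟩
      · by_cases hm' : m' = m
        · subst hm'; have := hmem.1 m'; rw [add_single_apply_self] at this; simp at this ⊢; omega
        · have := hmem.1 m'; rwa [add_single_apply_of_ne x hm'] at this
      · by_cases hm' : m' = m
        · subst hm'; have := hmem.2 m'; rw [add_single_apply_self] at this; simp at this ⊢; omega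
        · have := hmem.2 m'; rwa [add_single_apply_of_ne x hm'] at this
    refine h.eq_zero_of_seam (m := m) (Or.inl ?_) i j
    simp only [Torus.proj_apply, Pi.add_apply, Pi.single_eq_same, hxm]
    simp
  · rfl

/-- **Cutting the torus open preserves closedness**: the extension by zero to `ℤ^d` of a closed
torus `2`-cochain supported away from the seam is closed. [folklore] -/
theorem d₂_liftCochain {ω : Site d L → Fin d → Fin d → A} {a b : Literature.Probability.LatticeModels.Site d}
    (h : LiftBox ω a b) (hcl : ∀ y i j k, td₂ ω y i j k = 0) (x : Literature.Probability.LatticeModels.Site d) (i j k : Fin d) :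
    d₂ (liftCochain ω) x i j k = 0 := by
  classical
  by_cases hx : x ∈ fundBox d L
  · have h0 : liftCochain ω x = ω (Torus.proj L x) := by
      funext i' j'; simp [liftCochain, hx]
    simp only [d₂, liftCochain_add_e h hx, h0]
    exact hcl _ i j k
  · have h0 : ∀ i' j', liftCochain ω x i' j' = 0 := fun i' j' => by simp [liftCochain, hx]
    simp only [d₂, liftCochain_add_e_of_not_mem h hx, h0]
    abel

/-- Key pointwise identity behind `td₁_pushCochain`: a `ℤ^d` cochain supported in `[a,b] ⊆ [1,L-2]^d`
takes the same value at the canonical lift of `y + eₘ` and at `lift y + eₘ` (in the wrap-around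
case both points are outside the support). [folklore] -/
theorem apply_torusSiteLift_add_te {θ : Literature.Probability.LatticeModels.Site d → Fin d → A} {a b : Literature.Probability.LatticeModels.Site d} (ha : ∀ m, 1 ≤ a m)
    (hb : ∀ m, b m ≤ (L : ℤ) - 2) (hθ : ∀ x i, θ x i ≠ 0 → x ∈ Set.Icc a b)
    (y : Site d L) (m c : Fin d) :
    θ (torusSiteLift (y + te m)) c = θ (torusSiteLift y + e m) c := by
  rw [torusSiteLift_add_te]
  split_ifs with hwrap
  · -- both sides vanish
    have h1 : θ (update (torusSiteLift y) m 0) c = 0 := by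
      by_contra hne
      have h' : a m ≤ 0 := by simpa using (hθ _ c hne).1 m
      have := ha m
      omega
    have h2 : θ (torusSiteLift y + e m) c = 0 := by
      by_contra hne
      have h' : ((y m).val : ℤ) + 1 ≤ b m := by
        have := (hθ _ c hne).2 m
        rwa [add_single_apply_self] at this
      have := hb m
      omega
    rw [h1, h2]
  · rfl

/-- **Pushing the primitive back to the torus**: if `θ` is supported in `[a,b] ⊆ [1,L-2]^d` then
`td₁ (push θ) y = d₁ θ (lift y)`. [folklore] -/
theorem td₁_pushCochain {θ : Literature.Probability.LatticeModels.Site d → Fin d → A} {a b : Literature.Probability.LatticeModels.Site d} (ha : ∀ m, 1 ≤ a m)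
    (hb : ∀ m, b m ≤ (L : ℤ) - 2) (hθ : ∀ x i, θ x i ≠ 0 → x ∈ Set.Icc a b)
    (y : Site d L) (i j : Fin d) :
    td₁ (pushCochain θ) y i j = d₁ θ (torusSiteLift y) i j := by
  simp only [td₁, d₁, pushCochain, apply_torusSiteLift_add_te ha hb hθ]

/-- **Small closed `2`-cochains on the torus are exact (with support control).** On `(ℤ/Lℤ)^d`,
`d ≥ 3`, let `ω` be an alternating `2`-cochain, closed (`td₂ ω = 0` on all index triples), whose
non-zero plaquettes have base points with canonical coordinates in a box `[a, b]`, `1 ≤ a`,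
`b ≤ L - 2`. Then `ω = td₁ θ` for a `1`-cochain `θ` whose non-zero edges have base points with
canonical coordinates in `[a, b]`. (Cut the torus open along the seam, `d₂_liftCochain`; apply the
Poincaré lemma with compact supports on `ℤ^d`; push back, `td₁_pushCochain`.) In the contour
expansion: a closed vortex not wrapping around the torus is the plaquette field of a gauge field
supported in the bounding box of the vortex. [cite: ForsstromLenellsViklund2022, §2 (Lemma 2.2, the Poincaré lemma)] -/
theorem exists_td₁_eq_of_liftBox (hd : 3 ≤ d) {ω : Site d L → Fin d → Fin d → A}
    {a b : Literature.Probability.LatticeModels.Site d} (hω : IsAlt ω) (hcl : ∀ y i j k, td₂ ω y i j k = 0) (hbox : LiftBox ω a b) :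
    ∃ θ : Site d L → Fin d → A, td₁ θ = ω ∧
      ∀ y i, θ y i ≠ 0 → torusSiteLift y ∈ Set.Icc a b := by
  obtain ⟨θ, hθ, hsupp⟩ := exists_d₁_eq_of_d₂_eq_zero_of_three_le hd (liftCochain ω) a b
    (isAlt_liftCochain hω).1 (isAlt_liftCochain hω).2 (d₂_liftCochain hbox hcl)
    (fun x i j hx => liftCochain_ne_zero hbox hx)
  refine ⟨pushCochain θ, ?_, fun y i hy => hsupp _ i hy⟩
  funext y i j
  rw [td₁_pushCochain hbox.one_le hbox.le_sub_two hsupp, hθ]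
  classical
  simp only [liftCochain, if_pos (torusSiteLift_mem_fundBox y), torusProj_torusSiteLift]

end Transfer


/-! ### Translations -/

/-- Translate a torus `1`-cochain: `(shiftCochain₁ v θ) x = θ (x + v)`. [folklore] -/
def shiftCochain₁ (v : Site d L) (θ : Site d L → Fin d → A) : Site d L → Fin d → A :=
  fun x => θ (x + v)

/-- Translate a torus `2`-cochain: `(shiftCochain₂ v ω) x = ω (x + v)`. [folklore] -/
def shiftCochain₂ (v : Site d L) (ω : Site d L → Fin d → Fin d → A) : Site d L → Fin d → Fin d → A :=
  fun x => ω (x + v)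

/-- `td₁` commutes with translations. [folklore] -/
theorem td₁_shiftCochain₁ (v : Site d L) (θ : Site d L → Fin d → A) :
    td₁ (shiftCochain₁ v θ) = shiftCochain₂ v (td₁ θ) := by
  funext x i j
  simp only [td₁, shiftCochain₁, shiftCochain₂, add_right_comm x _ v]

/-- `td₂` commutes with translations. [folklore] -/
theorem td₂_shiftCochain₂ (v : Site d L) (ω : Site d L → Fin d → Fin d → A) (x : Site d L)
    (i j k : Fin d) : td₂ (shiftCochain₂ v ω) x i j k = td₂ ω (x + v) i j k := by
  simp only [td₂, shiftCochain₂, add_right_comm x _ v]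

/-- Translates of alternating cochains are alternating. [folklore] -/
theorem IsAlt.shiftCochain₂ {ω : Site d L → Fin d → Fin d → A} (h : IsAlt ω) (v : Site d L) :
    IsAlt (shiftCochain₂ v ω) :=
  ⟨fun x i j => h.1 (x + v) i j, fun x i => h.2 (x + v) i⟩

omit [AddCommGroup A] in
/-- Undo a translation: `shiftCochain₂ (-v) (shiftCochain₂ v ω) = ω`. [folklore] -/
theorem shiftCochain₂_neg_shiftCochain₂ (v : Site d L) (ω : Site d L → Fin d → Fin d → A) :
    shiftCochain₂ (-v) (shiftCochain₂ v ω) = ω := by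
  funext x i j; simp [shiftCochain₂]

/-- **Translating a small set of sites away from the seam.** If `S` is a set of torus sites with
`2 |S| < L`, there is a translation vector `v` such that every coordinate of every `y - v`,
`y ∈ S`, avoids the residues `0` and `-1` (in each coordinate the at most `2|S|` forbidden values
of `v` do not exhaust `ℤ/Lℤ`). [folklore] -/
theorem exists_shift_away [NeZero L] (S : Finset (Site d L)) (hS : 2 * S.card < L) :
    ∃ v : Site d L, ∀ y ∈ S, ∀ m : Fin d, y m - v m ≠ 0 ∧ y m - v m ≠ -1 := by
  classical
  have hcoord : ∀ m : Fin d, ∃ c : ZMod L, c ∉ S.image (fun y => y m) ∪ S.image (fun y => y m + 1) := by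
    intro m
    have hlt : (S.image (fun y => y m) ∪ S.image (fun y => y m + 1)).card < (Finset.univ : Finset (ZMod L)).card := by
      calc (S.image (fun y => y m) ∪ S.image (fun y => y m + 1)).card
          ≤ (S.image (fun y => y m)).card + (S.image (fun y => y m + 1)).card := Finset.card_union_le _ _
        _ ≤ S.card + S.card := add_le_add Finset.card_image_le Finset.card_image_le
        _ < L := by omega
        _ = (Finset.univ : Finset (ZMod L)).card := by rw [Finset.card_univ, ZMod.card]
    obtain ⟨c, -, hc⟩ := Finset.exists_mem_notMem_of_card_lt_card hlt
    exact ⟨c, hc⟩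
  choose c hc using hcoord
  refine ⟨fun m => c m, fun y hy m => ⟨fun h0 => ?_, fun h1 => ?_⟩⟩
  · apply hc m
    rw [Finset.mem_union, Finset.mem_image]
    exact Or.inl ⟨y, hy, sub_eq_zero.1 h0⟩
  · apply hc m
    rw [Finset.mem_union, Finset.mem_image, Finset.mem_image]
    refine Or.inr ⟨y, hy, ?_⟩
    have := sub_eq_iff_eq_add.1 h1
    rw [this]; ring

/-- A residue avoiding `0` and `-1` has canonical representative in `[1, L-2]`. [folklore] -/
theorem val_mem_of_ne [NeZero L] {z : ZMod L} (h0 : z ≠ 0) (h1 : z ≠ -1) :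
    (1 : ℤ) ≤ (z.val : ℤ) ∧ (z.val : ℤ) ≤ (L : ℤ) - 2 := by
  have hL : 0 < L := Nat.pos_of_ne_zero (NeZero.ne L)
  have hv0 : z.val ≠ 0 := fun h => h0 ((ZMod.val_eq_zero z).1 h)
  have hvlt : z.val < L := ZMod.val_lt z
  have hv1 : z.val ≠ L - 1 := by
    intro h
    apply h1
    have hz : z = ((z.val : ℕ) : ZMod L) := (ZMod.natCast_zmod_val z).symm
    rw [hz, h, Nat.cast_sub (by omega), Nat.cast_one, ZMod.natCast_self, zero_sub]
  constructor <;> omega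

/-! ### Genuine plaquettes, cubes, faces, adjacency -/

/-- Restrict an (alternating) `2`-cochain to the genuine plaquettes `(x; i < j)` of the torus
(Wave 0's `Plaquette d L`). [folklore] -/
def res (ω : Site d L → Fin d → Fin d → A) : Plaquette d L → A := fun p => ω p.1 p.2.1.1 p.2.1.2

/-- Extend a function of the genuine plaquettes to an alternating `2`-cochain. [folklore] -/
def ext (η : Plaquette d L → A) : Site d L → Fin d → Fin d → A := fun x i j =>
  if h : i < j then η (x, ⟨(i, j), h⟩) else if h' : j < i then -η (x, ⟨(j, i), h'⟩) else 0

/-- The value of `ext η` on a genuine plaquette. [folklore] -/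
theorem ext_apply_of_lt (η : Plaquette d L → A) (x : Site d L) {i j : Fin d} (h : i < j) :
    ext η x i j = η (x, ⟨(i, j), h⟩) := by
  simp [ext, h]

/-- `ext η` is alternating. [folklore] -/
theorem isAlt_ext (η : Plaquette d L → A) : IsAlt (ext η) := by
  refine ⟨fun x i j => ?_, fun x i => by simp [ext]⟩
  rcases lt_trichotomy i j with h | rfl | h
  · simp [ext, h, not_lt.2 h.le]
  · simp [ext]
  · simp [ext, h, not_lt.2 h.le]

/-- `res ∘ ext = id`. [folklore] -/
@[simp] theorem res_ext (η : Plaquette d L → A) : res (ext η) = η := by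
  funext ⟨x, ⟨⟨i, j⟩, h⟩⟩
  simp [res, ext, h]

/-- `ext ∘ res = id` on alternating cochains. [folklore] -/
theorem ext_res {ω : Site d L → Fin d → Fin d → A} (hω : IsAlt ω) : ext (res ω) = ω := by
  funext x i j
  rcases lt_trichotomy i j with h | rfl | h
  · simp [ext, res, h]
  · simp [ext, hω.2 x i]
  · simp [ext, res, h, not_lt.2 h.le, hω.1 x j i]

/-- `ext` is additive. [folklore] -/
theorem ext_add (η η' : Plaquette d L → A) : ext (η + η') = ext η + ext η' := by
  funext x i j
  simp only [ext, Pi.add_apply]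
  split_ifs <;> abel

/-- `ext 0 = 0`. [folklore] -/
@[simp] theorem ext_zero : ext (0 : Plaquette d L → A) = 0 := by
  funext x i j; simp [ext]

/-- `ext` of a finite sum. [folklore] -/
theorem ext_sum {ι : Type*} (s : Finset ι) (η : ι → Plaquette d L → A) :
    ext (∑ c ∈ s, η c) = ∑ c ∈ s, ext (η c) := by
  classical
  induction s using Finset.induction_on with
  | empty => simp
  | insert a s ha ih => rw [Finset.sum_insert ha, Finset.sum_insert ha, ext_add, ih]

/-- A function of the genuine plaquettes is **closed** if its alternating extension is
`td₂`-closed (no flux out of any `3`-cell: for the plaquette field of a gauge configuration this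
is the Bianchi identity). [folklore] -/
def IsClosedPl (η : Plaquette d L → A) : Prop := ∀ x i j k, td₂ (ext η) x i j k = 0

/-- The plaquette field of an abelian gauge field is closed (Bianchi identity, genuine form).
[folklore] -/
theorem isClosedPl_res_td₁ (θ : Site d L → Fin d → A) : IsClosedPl (res (td₁ θ)) := by
  intro x i j k
  rw [ext_res (isAlt_td₁ θ), td₂_td₁]
  rfl

/-- Sums of closed functions are closed. [folklore] -/
theorem IsClosedPl.add {η η' : Plaquette d L → A} (h : IsClosedPl η) (h' : IsClosedPl η') :
    IsClosedPl (η + η') := by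
  intro x i j k
  rw [ext_add, td₂_add, Pi.add_apply, Pi.add_apply, Pi.add_apply, Pi.add_apply, h, h', add_zero]

/-- The zero function is closed. [folklore] -/
theorem isClosedPl_zero : IsClosedPl (0 : Plaquette d L → A) := by
  intro x i j k; simp [td₂]

/-- Finite sums of closed functions are closed. [folklore] -/
theorem isClosedPl_sum {ι : Type*} (s : Finset ι) {η : ι → Plaquette d L → A}
    (h : ∀ c ∈ s, IsClosedPl (η c)) : IsClosedPl (∑ c ∈ s, η c) := by
  classical
  induction s using Finset.induction_on with
  | empty => simpa using isClosedPl_zero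
  | insert a s ha ih =>
    rw [Finset.sum_insert ha]
    exact (h a (Finset.mem_insert_self a s)).add (ih fun c hc => h c (Finset.mem_insert_of_mem hc))

/-- The six faces of the genuine `3`-cell `(x; i < j < k)` as genuine plaquettes. [folklore] -/
def cubeFaces (x : Site d L) {i j k : Fin d} (hij : i < j) (hjk : j < k) : Finset (Plaquette d L) :=
  {(x, ⟨(j, k), hjk⟩), (x + te i, ⟨(j, k), hjk⟩), (x, ⟨(i, k), hij.trans hjk⟩),
    (x + te j, ⟨(i, k), hij.trans hjk⟩), (x, ⟨(i, j), hij⟩), (x + te k, ⟨(i, j), hij⟩)}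

/-- **The flux through a genuine `3`-cell in terms of genuine plaquettes.** [folklore] -/
theorem td₂_ext_sorted (η : Plaquette d L → A) (x : Site d L) {i j k : Fin d} (hij : i < j)
    (hjk : j < k) :
    td₂ (ext η) x i j k =
      (η (x + te i, ⟨(j, k), hjk⟩) - η (x, ⟨(j, k), hjk⟩)) -
        (η (x + te j, ⟨(i, k), hij.trans hjk⟩) - η (x, ⟨(i, k), hij.trans hjk⟩)) +
        (η (x + te k, ⟨(i, j), hij⟩) - η (x, ⟨(i, j), hij⟩)) := by
  simp only [td₂, ext_apply_of_lt η _ hij, ext_apply_of_lt η _ hjk, ext_apply_of_lt η _ (hij.trans hjk)]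

/-- Functions agreeing on the six faces of a genuine `3`-cell have the same flux through it.
[folklore] -/
theorem td₂_ext_congr {η η' : Plaquette d L → A} {x : Site d L} {i j k : Fin d} (hij : i < j)
    (hjk : j < k) (h : ∀ f ∈ cubeFaces x hij hjk, η f = η' f) :
    td₂ (ext η) x i j k = td₂ (ext η') x i j k := by
  rw [td₂_ext_sorted η x hij hjk, td₂_ext_sorted η' x hij hjk]
  simp only [cubeFaces, Finset.mem_insert, Finset.mem_singleton, forall_eq_or_imp, forall_eq] at h
  obtain ⟨h1, h2, h3, h4, h5, h6⟩ := h
  rw [h1, h2, h3, h4, h5, h6]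

/-- A function vanishing on the six faces of a genuine `3`-cell has no flux through it. [folklore] -/
theorem td₂_ext_eq_zero_of_forall {η : Plaquette d L → A} {x : Site d L} {i j k : Fin d} (hij : i < j)
    (hjk : j < k) (h : ∀ f ∈ cubeFaces x hij hjk, η f = 0) : td₂ (ext η) x i j k = 0 := by
  rw [td₂_ext_congr hij hjk (η' := 0) (by simpa using h)]
  simp [td₂]

/-- **Cube adjacency** of genuine plaquettes: they are faces of a common genuine `3`-cell (the
connectedness notion for vortices, Forsström 2022 §1.3: "an edge between two distinct
plaquettes if both are in the boundary of a common 3-cell"). [cite: Forsstrom2022, §1.3 (the graph G(ω, ω'))] -/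
def CubeAdj (p q : Plaquette d L) : Prop :=
  ∃ (x : Site d L) (i j k : Fin d) (hij : i < j) (hjk : j < k),
    p ∈ cubeFaces x hij hjk ∧ q ∈ cubeFaces x hij hjk

/-- Cube adjacency is symmetric. [folklore] -/
theorem cubeAdj_symm {p q : Plaquette d L} (h : CubeAdj p q) : CubeAdj q p := by
  obtain ⟨x, i, j, k, hij, hjk, hp, hq⟩ := h
  exact ⟨x, i, j, k, hij, hjk, hq, hp⟩

/-- Restriction of a function of plaquettes to a finite plaquette set (zero outside). [folklore] -/
def restrictPl (η : Plaquette d L → A) (X : Finset (Plaquette d L)) : Plaquette d L → A :=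
  fun p => by classical exact if p ∈ X then η p else 0

/-- **Closedness is inherited by face-saturated restrictions.** If `η` is closed and the plaquette
set `X` is saturated in the sense that whenever a `3`-cell has a face in `X`, all its faces
carrying a non-zero value of `η` lie in `X`, then the restriction of `η` to `X` is closed. (Each
`3`-cell either sees `η|_X = η` on all its faces, or `η|_X = 0` on all of them.) This is why the
cube-connected components of a vortex configuration are themselves closed vortices. [folklore] -/
theorem isClosedPl_restrictPl {η : Plaquette d L → A} (hη : IsClosedPl η) {X : Finset (Plaquette d L)}
    (hsat : ∀ (x : Site d L) (i j k : Fin d) (hij : i < j) (hjk : j < k),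
      ∀ f ∈ cubeFaces x hij hjk, ∀ g ∈ cubeFaces x hij hjk, f ∈ X → η g ≠ 0 → g ∈ X) :
    IsClosedPl (restrictPl η X) := by
  classical
  intro x i j k
  refine td₂_eq_zero_of_sorted (isAlt_ext _) (fun y i j k hij hjk => ?_) x i j k
  by_cases hX : ∃ f ∈ cubeFaces y hij hjk, f ∈ X
  · obtain ⟨f, hf, hfX⟩ := hX
    rw [td₂_ext_congr hij hjk (η' := η) (fun g hg => ?_)]
    · exact hη y i j k
    · unfold restrictPl
      split_ifs with hgX
      · rfl
      · by_contra hne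
        exact hgX (hsat y i j k hij hjk f hf g hg hfX (Ne.symm hne))
  · push Not at hX
    exact td₂_ext_eq_zero_of_forall hij hjk fun g hg => by
      unfold restrictPl; rw [if_neg (hX g hg)]

/-- The restriction vanishes outside `X` and agrees with `η` on `X`. [folklore] -/
theorem restrictPl_apply (η : Plaquette d L → A) (X : Finset (Plaquette d L)) (p : Plaquette d L) :
    restrictPl η X p = if p ∈ X then η p else 0 := by
  unfold restrictPl; congr

/-- Base points of cube-adjacent plaquettes differ by `0` or `±1` in every coordinate (the base
points of the faces of the `3`-cell at `x` are `x, x+eᵢ, x+eⱼ, x+e_k`). [folklore] -/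
theorem CubeAdj.coord_sub {p q : Plaquette d L} (h : CubeAdj p q) (m : Fin d) :
    q.1 m - p.1 m = 0 ∨ q.1 m - p.1 m = 1 ∨ q.1 m - p.1 m = -1 := by
  obtain ⟨x, i, j, k, hij, hjk, hp, hq⟩ := h
  -- both base points are of the form `x + δ` with `δ ∈ {0, eᵢ, eⱼ, e_k}`
  have hbase : ∀ {r : Plaquette d L}, r ∈ cubeFaces x hij hjk →
      r.1 = x ∨ r.1 = x + te i ∨ r.1 = x + te j ∨ r.1 = x + te k := by
    intro r hr
    simp only [cubeFaces, Finset.mem_insert, Finset.mem_singleton] at hr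
    rcases hr with rfl | rfl | rfl | rfl | rfl | rfl <;> simp
  have hcoord : ∀ (y : Site d L) (n : Fin d),
      (y + te n : Site d L) m - y m = 0 ∨ (y + te n : Site d L) m - y m = 1 := by
    intro y n
    by_cases hmn : m = n
    · subst hmn; right; simp
    · left; simp [Pi.single_eq_of_ne hmn]
  -- enumerate
  have key : ∀ (a b : Site d L), (a = x ∨ a = x + te i ∨ a = x + te j ∨ a = x + te k) →
      (b = x ∨ b = x + te i ∨ b = x + te j ∨ b = x + te k) →
      b m - a m = 0 ∨ b m - a m = 1 ∨ b m - a m = -1 := by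
    intro a b ha hb
    -- `b m - a m = (b m - x m) - (a m - x m)` with both brackets in `{0, 1}`
    have hb' : b m - x m = 0 ∨ b m - x m = 1 := by
      rcases hb with rfl | rfl | rfl | rfl
      · left; simp
      all_goals exact hcoord x _
    have ha' : a m - x m = 0 ∨ a m - x m = 1 := by
      rcases ha with rfl | rfl | rfl | rfl
      · left; simp
      all_goals exact hcoord x _
    have hsplit : b m - a m = (b m - x m) - (a m - x m) := by ring
    rw [hsplit]
    rcases hb' with h1 | h1 <;> rcases ha' with h2 | h2 <;> simp [h1, h2]
  exact key p.1 q.1 (hbase hp) (hbase hq)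

/-- The candidate neighbourhood of a plaquette for cube adjacency: all faces of all index triples
based at the base point of `p` or at one of its backward neighbours `p.1 - eₘ`. [folklore] -/
noncomputable def cubeNbr (p : Plaquette d L) : Finset (Plaquette d L) := by
  classical
  exact ((insert p.1 (Finset.univ.image fun m : Fin d => p.1 - te m)) ×ˢ
      (Finset.univ : Finset (Fin d × Fin d × Fin d))).biUnion
    fun c => if hij : c.2.1 < c.2.2.1 then
      if hjk : c.2.2.1 < c.2.2.2 then cubeFaces c.1 hij hjk else ∅ else ∅

/-- A genuine `3`-cell has (at most) six faces. [folklore] -/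
theorem card_cubeFaces_le (x : Site d L) {i j k : Fin d} (hij : i < j) (hjk : j < k) :
    (cubeFaces x hij hjk).card ≤ 6 := by
  unfold cubeFaces
  exact Finset.card_le_six

/-- Cube-adjacent plaquettes lie in the candidate neighbourhood. [folklore] -/
theorem mem_cubeNbr_of_cubeAdj {p q : Plaquette d L} (h : CubeAdj p q) : q ∈ cubeNbr p := by
  classical
  obtain ⟨x, i, j, k, hij, hjk, hp, hq⟩ := h
  unfold cubeNbr
  rw [Finset.mem_biUnion]
  refine ⟨(x, (i, j, k)), ?_, ?_⟩
  · rw [Finset.mem_product]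
    refine ⟨?_, Finset.mem_univ _⟩
    -- the base point of the cube is `p.1` or `p.1 - eₘ` for `m ∈ {i, j, k}`
    simp only [cubeFaces, Finset.mem_insert, Finset.mem_singleton] at hp
    rw [Finset.mem_insert, Finset.mem_image]
    rcases hp with rfl | rfl | rfl | rfl | rfl | rfl
    · exact Or.inl rfl
    · exact Or.inr ⟨i, Finset.mem_univ _, by simp⟩
    · exact Or.inl rfl
    · exact Or.inr ⟨j, Finset.mem_univ _, by simp⟩
    · exact Or.inl rfl
    · exact Or.inr ⟨k, Finset.mem_univ _, by simp⟩
  · simp only [dif_pos hij, dif_pos hjk]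
    exact hq

/-- A crude bound on the size of the candidate neighbourhood: `6 (d + 1) d³`. [folklore] -/
theorem card_cubeNbr_le [NeZero L] (p : Plaquette d L) : (cubeNbr p).card ≤ 6 * ((d + 1) * d ^ 3) := by
  classical
  unfold cubeNbr
  refine Finset.card_biUnion_le.trans ?_
  have hterm : ∀ c ∈ (insert p.1 (Finset.univ.image fun m : Fin d => p.1 - te m)) ×ˢ
      (Finset.univ : Finset (Fin d × Fin d × Fin d)),
      (if hij : c.2.1 < c.2.2.1 then
        if hjk : c.2.2.1 < c.2.2.2 then cubeFaces c.1 hij hjk else ∅ else ∅).card ≤ 6 := by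
    intro c _
    split_ifs with hij hjk
    · exact card_cubeFaces_le _ hij hjk
    · simp
    · simp
  refine (Finset.sum_le_sum hterm).trans ?_
  rw [Finset.sum_const, smul_eq_mul, mul_comm]
  refine Nat.mul_le_mul_left 6 ?_
  rw [Finset.card_product]
  refine Nat.mul_le_mul ?_ ?_
  · refine (Finset.card_insert_le p.1 _).trans ?_
    have h := Finset.card_image_le (s := (Finset.univ : Finset (Fin d)))
      (f := fun m : Fin d => p.1 - te m)
    rw [Finset.card_univ, Fintype.card_fin] at h
    omega
  · simp [Finset.card_univ, pow_succ, pow_zero, mul_assoc]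

/-! ### Abelian Stokes for rectangles -/

/-- Additive line sum of a `1`-cochain along `n` forward steps in direction `i` from `y`
(the additive version of Wave 0's `lineHolonomy`). [folklore] -/
def lineSum (θ : Site d L → Fin d → A) (i : Fin d) : ℕ → Site d L → A
  | 0, _ => 0
  | n + 1, y => θ y i + lineSum θ i n (y + te i)

/-- `lineSum` from the other end: `lineSum θ i (n+1) y = lineSum θ i n y + θ (y + n eᵢ) i`. [folklore] -/
theorem lineSum_succ' (θ : Site d L → Fin d → A) (i : Fin d) (n : ℕ) (y : Site d L) :
    lineSum θ i (n + 1) y = lineSum θ i n y + θ (y + (n : ZMod L) • te i) i := by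
  induction n generalizing y with
  | zero => simp [lineSum]
  | succ n ih =>
    rw [lineSum, ih (y + te i), lineSum]
    have : y + te i + ((n : ℕ) : ZMod L) • te i = y + ((n + 1 : ℕ) : ZMod L) • te i := by
      rw [add_assoc, Nat.cast_succ, add_smul, one_smul, add_comm (te i)]
    rw [this, add_assoc]

/-- `lineSum` as a `Finset.range` sum. [folklore] -/
theorem lineSum_eq_sum (θ : Site d L → Fin d → A) (i : Fin d) (n : ℕ) (y : Site d L) :
    lineSum θ i n y = ∑ a ∈ Finset.range n, θ (y + (a : ZMod L) • te i) i := by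
  induction n with
  | zero => simp [lineSum]
  | succ n ih => rw [lineSum_succ', Finset.sum_range_succ, ih]

/-- **Abelian Stokes theorem for rectangles** (additive form): the sum of a `1`-cochain around the
boundary of the `R × T` rectangle at `x` in the `(i, j)` plane (sides: `R` steps along `eᵢ`, `T`
steps along `eⱼ`, back along `-eᵢ`, back along `-eⱼ`) equals the sum of its plaquette variables
`td₁ θ` over the `R T` plaquettes of the rectangle. [folklore] -/
theorem lineSum_rect_eq_sum_td₁ (θ : Site d L → Fin d → A) (x : Site d L) (i j : Fin d) (R T : ℕ) :
    lineSum θ i R x + lineSum θ j T (x + (R : ZMod L) • te i) - lineSum θ i R (x + (T : ZMod L) • te j)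
        - lineSum θ j T x =
      ∑ b ∈ Finset.range T, ∑ a ∈ Finset.range R,
        td₁ θ (x + (a : ZMod L) • te i + (b : ZMod L) • te j) i j := by
  induction T with
  | zero => simp [lineSum]
  | succ T ih =>
    rw [Finset.sum_range_succ, ← ih, lineSum_succ', lineSum_succ']
    -- the new row of plaquettes
    have hrow : ∑ a ∈ Finset.range R, td₁ θ (x + (a : ZMod L) • te i + (T : ZMod L) • te j) i j =
        (lineSum θ i R (x + (T : ZMod L) • te j) - lineSum θ i R (x + ((T + 1 : ℕ) : ZMod L) • te j))
          + (θ (x + (R : ZMod L) • te i + (T : ZMod L) • te j) j - θ (x + (T : ZMod L) • te j) j) := by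
      simp only [td₁]
      rw [Finset.sum_sub_distrib, Finset.sum_sub_distrib, Finset.sum_add_distrib]
      -- telescoping of the `j`-components
      have htel : ∑ a ∈ Finset.range R, (θ (x + (a : ZMod L) • te i + (T : ZMod L) • te j + te i) j) -
          ∑ a ∈ Finset.range R, θ (x + (a : ZMod L) • te i + (T : ZMod L) • te j) j =
          θ (x + (R : ZMod L) • te i + (T : ZMod L) • te j) j - θ (x + (T : ZMod L) • te j) j := by
        have key : ∀ a : ℕ, x + (a : ZMod L) • te i + (T : ZMod L) • te j + te i =
            x + ((a + 1 : ℕ) : ZMod L) • te i + (T : ZMod L) • te j := by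
          intro a; rw [Nat.cast_succ, add_smul, one_smul]; abel
        simp only [key]
        rw [← Finset.sum_sub_distrib]  -- undo, then telescope
        rw [Finset.sum_range_sub (f := fun a : ℕ => θ (x + (a : ZMod L) • te i + (T : ZMod L) • te j) j)]
        simp
      -- the `i`-components are the two line sums
      have hl1 : ∑ a ∈ Finset.range R, θ (x + (a : ZMod L) • te i + (T : ZMod L) • te j) i =
          lineSum θ i R (x + (T : ZMod L) • te j) := by
        rw [lineSum_eq_sum]
        refine Finset.sum_congr rfl fun a _ => ?_
        rw [add_right_comm]
      have hl2 : ∑ a ∈ Finset.range R, θ (x + (a : ZMod L) • te i + (T : ZMod L) • te j + te j) i =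
          lineSum θ i R (x + ((T + 1 : ℕ) : ZMod L) • te j) := by
        rw [lineSum_eq_sum]
        refine Finset.sum_congr rfl fun a _ => ?_
        rw [Nat.cast_succ, add_smul, one_smul]; abel_nf
      rw [hl1, hl2]
      have := htel
      -- combine
      rw [sub_eq_iff_eq_add] at this
      rw [this]
      abel
    rw [hrow]
    abel

end LatticeForm

end Literature.MathematicalPhysics.QuantumFieldTheory
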